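import Mathlib
import Summits.ValiantsHypothesis.ValiantsHypothesis.Theorems.TwoProducts.Negative.RankTwoEscapes
import Summits.ValiantsHypothesis.ValiantsHypothesis.Theorems.TwoProducts.Negative.CommonPadding
import HarnessLib

/-!
# NEGATIVE lane (val-neg-1 g5): COMMON DEEP PADDING — the no-datum (rank ≥ 2) residual is the whole per-cell law

Helper file for crux `stmt-ValiantsHypothesis-5906` (`TwoProducts`), filed `--supports`; it closes NO item, proves NO summit statement,
and does NOT prove `TwoProducts`, `PlanarCellBound` or VP ≠ VNP.  0 `def`s; every law below is stated inline.  The kit lemmas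
(`logDiff_append_common`, `validWeight_append_iff`, `isCellFamily_append_common`, `wt_nsmul_tailSum_lt`, `wt_nsmul_tailSum_le_iff`,
`planted_pair`, `tailSupport_nonempty_of_isCellFamily`, gadget support facts) are in `Negative/CommonPadding.lean` (same seat).

## Finding
Let `(u, v) : Fin m → MvPolynomial (Fin 2) ℂ` be normalised (`coeff 0 = 0`), `t`-sparse, with a tail letter; `T = tailSupport u v`,
`s = Σ_{e ∈ T} e`.  Append to BOTH sides the four binomials `X^{2N s} + X^{4N s}` (twice) and `X^{3N s} + X^{6N s}` (twice), any `N ≥ 1`.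
Then (`exists_noDatum_padding`):
* `logDiff`, hence `logSupport`, is literally unchanged (`logDiff_append_common`): common factors cancel in the formal logarithm;
* `ValidWeight` is unchanged (`validWeight_append_iff`; the new letters `n • s`, `n ≥ 2`, are `ξ`-negative for every valid `ξ`);
* every new tail letter lies STRICTLY BELOW every old one for every valid weight (`wt_nsmul_tailSum_lt`:
  `wt ξ (n • s) ≤ 2 · wt ξ s < wt ξ s ≤ wt ξ e` for `e ∈ T`), and the new letters are ordered among themselves by `n` alone
  (`wt_nsmul_tailSum_le_iff`); hence every cell family `S` of `(u, v, R)` is a cell family of the padded instance for the explicit relation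
  `R' e e' := (e ∈ T → e' ∈ T ∧ R e e') ∧ (e ∉ T → e' ∈ T ∨ |e'|₁ ≤ |e|₁)` (`isCellFamily_append_common`);
* the padded letter family carries the two planted equal-sum coincidences `(4N s ∣ 0) ~ (2N s ∣ 2N s)` and `(6N s ∣ 0) ~ (3N s ∣ 3N s)` with
  DISJOINT disagreement sets, so by `RankTwoEscape.no_rankOne_datum_of_two_coincidences` (p635223) it admits NO rank-one datum `(ρ⁺, ρ⁻)`
  whatsoever, and it is not of permutation type.
Consequently (`cellLaw_of_noDatumCellLaw`, `noDatumCellLaw_iff_cellLaw`): a per-cell law `#S ≤ 2^{a m} (t+2)^b` demanded only of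
datum-free instances implies the per-cell law for ALL instances with exponents `(a, b + 2a)` (`m ↦ m + 4`, `2^{4a} ≤ (t+2)^{2a}` as
`t ≥ 2`); and (`cellLaw_of_datumHatchCellLaw`) the same holds for the law demanded only of instances avoiding the SEVEN rank-one hatches
of the v20 residual (`FourTermRankOne`, `ThreeTermRankOne`, `ThreeTermAPRankOne`, `ThreeTermFreeRankOne`, `ThreeTermHomRankOne`,
`ThreeTermGenRankOne`, `TwoTermRankOne` of `Cruxes/TwoProducts/Lines/relation_ladder.lean` v20, inlined token-for-token): each hatch IS a
rank-one datum.

## What this says about the line (information for planner / lead; no verdict changes)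
`ResidualLawV20` = the `t ≥ 2` per-cell law under (R5) «no lattice-small block merge to permutation type», (R1_r) «no cheap class cover»,
and the seven datum hatches.  This file shows that the seven datum hatches BY THEMSELVES excise nothing asymptotically: modulo (R5)/(R1_r)
the residual is the full `t ≥ 2` per-cell law (the cell form consumed by `planarCellBound_v20`) over again, at exponent cost `b ↦ b + 2a`.
HONEST SCOPE: (i) the (R5)/(R1_r) threshold hypotheses of `ResidualLawV20` are NOT treated in this file.  On paper the same padding with
`N ≥ m + 1` respects both — (R5): a lattice-small block merge of the padded family either misses one of the four gadget positions, and then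
a planted pair survives the merge, or swallows all four, and then its block sumset is `19 ×` that of its old part (`19 > 16 =
2^{m+4} / 2^m`), so the old part is lattice-small for `(u, v)` and its non-permutation-type witness lifts; (R1_r): a class cover of the
padded family spends `≥ 1` class on the gadget coincidences, the remaining classes cover `(u, v)`, and `16 (m+1) ≤ (m+5) · 3 (6+m+C(m+4,2))²`
— so the expected sequel is «v20 residual ⇒ v12 residual (block-merge + class-cover hypotheses only), exponents `(a, b+2a)`»; its kernel
version is deferred to a sequel file and is NOT claimed here; (ii) symmetric padding is undone by the free normalisation «delete positions
carrying equal factors on the two sides», which the law as typed does not impose — a one-sided variant (pad `u` alone, letters far below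
the cone of `S`) would be the robust form and is not in this file; (iii) laws are compared AS TYPED (`∃ a b` shape, `t ≥ 2`, normalised
inputs, ground field `ℂ`).

Landed facts used: `RankTwoEscape.no_rankOne_datum_of_two_coincidences` (p635223); `ClassCoverBound.{swap_at_i, swap_at_j, swap_of_ne,
sum_swap}`, `TwoLetterEscape.msetT_swap`; `PlanarCell.{tuples, tailSupport, IsCellFamily}`; `FormalLogLinearisation.{wt, wt_add, wt_zero,
wt_nsmul, logCoeff, logDiff, logSupport, ValidWeight, IsStrictTop}`.  Axioms standard (no `native_decide`).  [folklore]
-/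

namespace Summit.ValiantsHypothesis.Theorems.TwoProducts.Negative.RankTwoPadding

open Finset MvPolynomial
open Summit.ValiantsHypothesis.ValiantsHypothesis.Theorems.NewtonUnitEquations.TwoProducts.FormalLogLinearisation
open Summit.ValiantsHypothesis.ValiantsHypothesis.Theorems.NewtonUnitEquations.TwoProducts.PlanarCell
open Summit.ValiantsHypothesis.ValiantsHypothesis.Theorems.NewtonUnitEquations.TwoProducts.PermutationType
  (msetT PermType RankOneCoincidences)
open Summit.ValiantsHypothesis.Theorems.TwoProducts.Negative.RankTwoEscape (no_rankOne_datum_of_two_coincidences)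
open Summit.ValiantsHypothesis.Theorems.TwoProducts.Negative.CommonPadding

variable {m : ℕ}

/-! ### THE PADDING: four common gadget factors plant a rank-two coincidence module and change nothing else -/

/-- **Common deep padding (explicit form; the gadget tuple `w` is pinned by the hypothesis `hw_def`, so that sequel files can add properties of the SAME padding).**  For a normalised `t`-sparse instance `(u, v)` with a tail letter and any `N ≥ 1`,
appending to BOTH sides the four binomials `X^{2N s}+X^{4N s}`, `X^{2N s}+X^{4N s}`, `X^{3N s}+X^{6N s}`, `X^{3N s}+X^{6N s}`
(`s = Σ_{e ∈ tailSupport} e`) gives a normalised `t`-sparse instance on `m + 4` positions with THE SAME log-support, THE SAME valid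
weights, every cell family of `(u, v)` still a cell family, all new tail letters `n • s` (`n ≥ 2N`) strictly below the old ones —
and a letter family that is NOT of permutation type and admits NO rank-one datum `(ρ⁺, ρ⁻)` whatsoever. [folklore] -/
theorem noDatum_padding_spec {t : ℕ} (ht : 2 ≤ t) (u v : Fin m → MvPolynomial (Fin 2) ℂ)
    (hu : ∀ j, coeff 0 (u j) = 0 ∧ (u j).support.card ≤ t) (hv : ∀ j, coeff 0 (v j) = 0 ∧ (v j).support.card ≤ t)
    (hT : (tailSupport u v).Nonempty) {N : ℕ} (hN : 1 ≤ N) (w : Fin 4 → MvPolynomial (Fin 2) ℂ)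
    (hw_def : w = fun i : Fin 4 =>
      if (i : ℕ) < 2 then monomial ((2 * N) • ∑ f ∈ tailSupport u v, f) (1 : ℂ) + monomial ((2 * (2 * N)) • ∑ f ∈ tailSupport u v, f) 1
      else monomial ((3 * N) • ∑ f ∈ tailSupport u v, f) (1 : ℂ) + monomial ((2 * (3 * N)) • ∑ f ∈ tailSupport u v, f) 1) :
      (∀ j, coeff 0 (Fin.append u w j) = 0 ∧ (Fin.append u w j).support.card ≤ t) ∧
      (∀ j, coeff 0 (Fin.append v w j) = 0 ∧ (Fin.append v w j).support.card ≤ t) ∧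
      logSupport (Fin.append u w) (Fin.append v w) = logSupport u v ∧
      (∀ ξ, ValidWeight (Fin.append u w) (Fin.append v w) ξ ↔ ValidWeight u v ξ) ∧
      (∀ e ∈ tailSupport (Fin.append u w) (Fin.append v w),
        e ∈ tailSupport u v ∨ ∃ n, 2 * N ≤ n ∧ e = n • ∑ f ∈ tailSupport u v, f) ∧
      (∀ (R : Expo → Expo → Prop) (S : Finset Expo), IsCellFamily u v R S →
        ∃ R' : Expo → Expo → Prop, IsCellFamily (Fin.append u w) (Fin.append v w) R' S) ∧
      ¬ PermType (fun j => (Fin.append u w j).support ∪ (Fin.append v w j).support) ∧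
      ∀ ρp ρm : Expo →₀ ℕ,
        ¬ RankOneCoincidences (fun j => (Fin.append u w j).support ∪ (Fin.append v w j).support) ρp ρm := by
  classical
  have hu0 : ∀ j, coeff 0 (u j) = 0 := fun j => (hu j).1
  have hv0 : ∀ j, coeff 0 (v j) = 0 := fun j => (hv j).1
  set s : Expo := ∑ f ∈ tailSupport u v, f with hs_def
  have hs0 : s ≠ 0 := tailSum_ne_zero hu0 hv0 hT
  have h2N : 2 * N ≠ 0 := by omega
  have h3N : 3 * N ≠ 0 := by omega
  -- the gadget tuple: positions 0, 1 carry `X^{2N s} + X^{4N s}`, positions 2, 3 carry `X^{3N s} + X^{6N s}` (hypothesis `hw_def`)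
  -- support of the gadget factors
  have hwsupp : ∀ i, ∀ e ∈ (w i).support, ∃ n, 2 * N ≤ n ∧ e = n • s := by
    intro i e he
    by_cases hi : (i : ℕ) < 2
    · have hwi : w i = monomial ((2 * N) • s) (1 : ℂ) + monomial ((2 * (2 * N)) • s) 1 := by
        simp only [hw_def, hi, if_true]
      rw [hwi] at he
      rcases mem_support_gadget he with h | h
      · exact ⟨2 * N, le_rfl, h⟩
      · exact ⟨2 * (2 * N), by omega, h⟩
    · have hwi : w i = monomial ((3 * N) • s) (1 : ℂ) + monomial ((2 * (3 * N)) • s) 1 := by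
        simp only [hw_def, hi, if_false]
      rw [hwi] at he
      rcases mem_support_gadget he with h | h
      · exact ⟨3 * N, by omega, h⟩
      · exact ⟨2 * (3 * N), by omega, h⟩
  have hwnorm : ∀ i, coeff 0 (w i) = 0 ∧ (w i).support.card ≤ t := by
    intro i
    by_cases hi : (i : ℕ) < 2
    · simp only [hw_def, hi, if_true]
      exact ⟨coeff_zero_gadget hs0 h2N, (card_support_gadget s (2 * N)).trans ht⟩
    · simp only [hw_def, hi, if_false]
      exact ⟨coeff_zero_gadget hs0 h3N, (card_support_gadget s (3 * N)).trans ht⟩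
  have hwtail : ∀ e ∈ tailSupport w w, ∃ n, 2 * N ≤ n ∧ e = n • s := by
    intro e he
    unfold tailSupport at he
    simp only [Finset.mem_union, Finset.mem_biUnion, Finset.mem_univ, true_and, or_self] at he
    obtain ⟨i, hi⟩ := he
    exact hwsupp i e hi
  -- the three hypotheses of `isCellFamily_append_common`
  have hneg : ∀ ξ, ValidWeight u v ξ → ValidWeight w w ξ := by
    intro ξ hval
    have key : ∀ i, ∀ e ∈ (w i).support, wt ξ e < 0 := by
      intro i e he
      obtain ⟨n, hn, rfl⟩ := hwsupp i e he
      rw [wt_nsmul]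
      have hsneg := wt_tailSum_neg hval hT
      have hn' : (1 : ℝ) ≤ n := by exact_mod_cast (show 1 ≤ n by omega)
      nlinarith
    exact ⟨key, key⟩
  have hdeep : ∀ ξ, ValidWeight u v ξ → ∀ e ∈ tailSupport u v, ∀ e' ∈ tailSupport w w, wt ξ e' < wt ξ e := by
    intro ξ hval e he e' he'
    obtain ⟨n, hn, rfl⟩ := hwtail e' he'
    exact wt_nsmul_tailSum_lt hval he (by omega)
  have hspos : 0 < s 0 + s 1 := by
    obtain ⟨c, hc⟩ := Finsupp.ne_iff.mp hs0
    simp only [Finsupp.coe_zero, Pi.zero_apply] at hc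
    rcases (Fin.exists_fin_two (p := fun c => s c ≠ 0)).mp ⟨c, hc⟩ with h | h
    · omega
    · omega
  have hQ : ∀ ξ, ValidWeight u v ξ → ∀ e ∈ tailSupport w w, ∀ e' ∈ tailSupport w w,
      ((e' 0 + e' 1 ≤ e 0 + e 1) ↔ wt ξ e ≤ wt ξ e') := by
    intro ξ hval e he e' he'
    obtain ⟨n, -, rfl⟩ := hwtail e he
    obtain ⟨n', -, rfl⟩ := hwtail e' he'
    rw [wt_nsmul_tailSum_le_iff hval hT]
    simp only [Finsupp.smul_apply, smul_eq_mul, ← mul_add]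
    constructor
    · exact fun h => Nat.le_of_mul_le_mul_right h hspos
    · exact fun h => Nat.mul_le_mul_right _ h
  -- the two planted pairs
  have h01 : (Fin.natAdd m (0 : Fin 4) : Fin (m + 4)) ≠ Fin.natAdd m 1 := by simp [Fin.ext_iff]
  have h23 : (Fin.natAdd m (2 : Fin 4) : Fin (m + 4)) ≠ Fin.natAdd m 3 := by simp [Fin.ext_iff]
  have hA : ∀ (i : Fin 4) (e : Expo), e ∈ (w i).support →
      e ∈ (Fin.append u w (Fin.natAdd m i)).support ∪ (Fin.append v w (Fin.natAdd m i)).support := by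
    intro i e he
    rw [Fin.append_right]
    exact Finset.mem_union_left _ he
  have hw0 : w 0 = monomial ((2 * N) • s) (1 : ℂ) + monomial ((2 * (2 * N)) • s) 1 := by simp [hw_def]
  have hw1 : w 1 = monomial ((2 * N) • s) (1 : ℂ) + monomial ((2 * (2 * N)) • s) 1 := by simp [hw_def]
  have hw2 : w 2 = monomial ((3 * N) • s) (1 : ℂ) + monomial ((2 * (3 * N)) • s) 1 := by simp [hw_def]
  have hw3 : w 3 = monomial ((3 * N) • s) (1 : ℂ) + monomial ((2 * (3 * N)) • s) 1 := by simp [hw_def]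
  obtain ⟨hg2a, hg2b⟩ := nsmul_mem_support_gadget (s := s) hs0 h2N
  obtain ⟨hg3a, hg3b⟩ := nsmul_mem_support_gadget (s := s) hs0 h3N
  obtain ⟨ha₁, hb₁, hs₁, hPa₁, hPb₁, hne₁⟩ :=
    planted_pair (A := fun j => (Fin.append u w j).support ∪ (Fin.append v w j).support) h01 hs0 h2N
      (hA 0 _ (by rw [hw0]; exact hg2a)) (hA 0 _ (by rw [hw0]; exact hg2b)) (hA 1 _ (by rw [hw1]; exact hg2a))
  obtain ⟨ha₂, hb₂, hs₂, hPa₂, hPb₂, hne₂⟩ :=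
    planted_pair (A := fun j => (Fin.append u w j).support ∪ (Fin.append v w j).support) h23 hs0 h3N
      (hA 2 _ (by rw [hw2]; exact hg3a)) (hA 2 _ (by rw [hw2]; exact hg3b)) (hA 3 _ (by rw [hw3]; exact hg3a))
  -- distinct letters across the two pairs
  have d1 : (2 * (2 * N)) • s ≠ (3 * N) • s := nsmul_ne_nsmul hs0 (by omega)
  have d2 : (2 * (2 * N)) • s ≠ (2 * (3 * N)) • s := nsmul_ne_nsmul hs0 (by omega)
  have d3 : (2 * N) • s ≠ (3 * N) • s := nsmul_ne_nsmul hs0 (by omega)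
  have d4 : (2 * N) • s ≠ (2 * (3 * N)) • s := nsmul_ne_nsmul hs0 (by omega)
  have hdis : ∀ e, msetT (Pi.single (Fin.natAdd m (0 : Fin 4)) ((2 * (2 * N)) • s) +
        Pi.single (Fin.natAdd m (1 : Fin 4)) (0 : Expo) : Fin (m + 4) → Expo) e =
      msetT (Pi.single (Fin.natAdd m (0 : Fin 4)) ((2 * N) • s) +
        Pi.single (Fin.natAdd m (1 : Fin 4)) ((2 * N) • s) : Fin (m + 4) → Expo) e ∨
      msetT (Pi.single (Fin.natAdd m (2 : Fin 4)) ((2 * (3 * N)) • s) +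
        Pi.single (Fin.natAdd m (3 : Fin 4)) (0 : Expo) : Fin (m + 4) → Expo) e =
      msetT (Pi.single (Fin.natAdd m (2 : Fin 4)) ((3 * N) • s) +
        Pi.single (Fin.natAdd m (3 : Fin 4)) ((3 * N) • s) : Fin (m + 4) → Expo) e := by
    intro e
    rw [hPa₁, hPb₁, hPa₂, hPb₂]
    by_cases he₁ : e = (2 * (2 * N)) • s
    · subst he₁; right; simp [d1.symm, d2.symm]
    by_cases he₂ : e = (2 * N) • s
    · subst he₂; right; simp [d3.symm, d4.symm]
    left; simp [Ne.symm he₁, Ne.symm he₂]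
  refine ⟨norm_append u w hu hwnorm, norm_append v w hv hwnorm, logSupport_append_common u v w,
    fun ξ => ?_, fun e he => ?_, fun R S hS => ⟨_, isCellFamily_append_common u v w _ hneg hdeep hQ R S hS⟩,
    fun hP => hne₁ (hP _ ha₁ _ hb₁ hs₁),
    fun ρp ρm => no_rankOne_datum_of_two_coincidences ha₁ hb₁ hs₁ hne₁ ha₂ hb₂ hs₂ hne₂ hdis ρp ρm⟩
  · rw [validWeight_append_iff]
    exact ⟨fun h => h.1, fun h => ⟨h, hneg ξ h⟩⟩
  · rw [tailSupport_append, Finset.mem_union] at he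
    rcases he with he | he
    · exact Or.inl he
    · exact Or.inr (hwtail e he)

/-- **Common deep padding (existence form).**  For a normalised `t`-sparse instance `(u, v)` with a tail letter and any `N ≥ 1`,
appending to BOTH sides the four binomials `X^{2N s}+X^{4N s}`, `X^{2N s}+X^{4N s}`, `X^{3N s}+X^{6N s}`, `X^{3N s}+X^{6N s}`
(`s = Σ_{e ∈ tailSupport} e`) gives a normalised `t`-sparse instance on `m + 4` positions with THE SAME log-support, THE SAME valid
weights, every cell family of `(u, v)` still a cell family, all new tail letters `n • s` (`n ≥ 2N`) strictly below the old ones —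
and a letter family that is NOT of permutation type and admits NO rank-one datum `(ρ⁺, ρ⁻)` whatsoever. [folklore] -/
theorem exists_noDatum_padding {t : ℕ} (ht : 2 ≤ t) (u v : Fin m → MvPolynomial (Fin 2) ℂ)
    (hu : ∀ j, coeff 0 (u j) = 0 ∧ (u j).support.card ≤ t) (hv : ∀ j, coeff 0 (v j) = 0 ∧ (v j).support.card ≤ t)
    (hT : (tailSupport u v).Nonempty) {N : ℕ} (hN : 1 ≤ N) :
    ∃ w : Fin 4 → MvPolynomial (Fin 2) ℂ,
      (∀ j, coeff 0 (Fin.append u w j) = 0 ∧ (Fin.append u w j).support.card ≤ t) ∧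
      (∀ j, coeff 0 (Fin.append v w j) = 0 ∧ (Fin.append v w j).support.card ≤ t) ∧
      logSupport (Fin.append u w) (Fin.append v w) = logSupport u v ∧
      (∀ ξ, ValidWeight (Fin.append u w) (Fin.append v w) ξ ↔ ValidWeight u v ξ) ∧
      (∀ e ∈ tailSupport (Fin.append u w) (Fin.append v w),
        e ∈ tailSupport u v ∨ ∃ n, 2 * N ≤ n ∧ e = n • ∑ f ∈ tailSupport u v, f) ∧
      (∀ (R : Expo → Expo → Prop) (S : Finset Expo), IsCellFamily u v R S →
        ∃ R' : Expo → Expo → Prop, IsCellFamily (Fin.append u w) (Fin.append v w) R' S) ∧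
      ¬ PermType (fun j => (Fin.append u w j).support ∪ (Fin.append v w j).support) ∧
      ∀ ρp ρm : Expo →₀ ℕ,
        ¬ RankOneCoincidences (fun j => (Fin.append u w j).support ∪ (Fin.append v w j).support) ρp ρm :=
  ⟨_, noDatum_padding_spec ht u v hu hv hT hN _ rfl⟩

/-! ### TRANSFER: a per-cell law for datum-free letter families is already the whole per-cell law

The three laws below are stated INLINE (no `def`s in this helper file).  `CellLaw` shape (the conclusion of all three):
`∃ a b, ∀ m, ∀ t ≥ 2, ∀ (u, v) normalised t-sparse, ∀ R S, IsCellFamily u v R S → #S ≤ 2^(a m) (t+2)^b` — the `t ≥ 2` per-cell form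
`planarCellBound_v20` consumes.  `NoDatumCellLaw`: the same, demanded ONLY of instances whose letter family admits no rank-one datum at all.
`DatumHatchCellLaw`: the same, demanded only of instances avoiding the seven rank-one escape hatches of the v20 residual (token-identical
inlinings of `FourTermRankOne`, `ThreeTermRankOne`, `ThreeTermAPRankOne`, `ThreeTermFreeRankOne`, `ThreeTermHomRankOne`, `ThreeTermGenRankOne`,
`TwoTermRankOne` of `Cruxes/TwoProducts/Lines/relation_ladder.lean` v20).  The block-merge (R5) and class-cover (R1_r) hypotheses of
`ResidualLawV20` are NOT examined here. -/

/-- **The no-datum residual is the whole per-cell law** (exponent cost `b ↦ b + 2a`).  Proof: pad by `exists_noDatum_padding` (`m ↦ m + 4`,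
same `t`, same cells), apply the hypothesis, and absorb `2^{4a} ≤ (t+2)^{2a}` (`t ≥ 2`). [folklore] -/
theorem cellLaw_of_noDatumCellLaw
    (h : ∃ a b : ℕ, ∀ (m t : ℕ), 2 ≤ t → ∀ (u v : Fin m → MvPolynomial (Fin 2) ℂ),
      (∀ j, coeff 0 (u j) = 0 ∧ (u j).support.card ≤ t) → (∀ j, coeff 0 (v j) = 0 ∧ (v j).support.card ≤ t) →
      (∀ ρp ρm : Expo →₀ ℕ, ¬ RankOneCoincidences (fun j => (u j).support ∪ (v j).support) ρp ρm) →
      ∀ (R : Expo → Expo → Prop) (S : Finset Expo), IsCellFamily u v R S → S.card ≤ 2 ^ (a * m) * (t + 2) ^ b) :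
    ∃ a b : ℕ, ∀ (m t : ℕ), 2 ≤ t → ∀ (u v : Fin m → MvPolynomial (Fin 2) ℂ),
      (∀ j, coeff 0 (u j) = 0 ∧ (u j).support.card ≤ t) → (∀ j, coeff 0 (v j) = 0 ∧ (v j).support.card ≤ t) →
      ∀ (R : Expo → Expo → Prop) (S : Finset Expo), IsCellFamily u v R S → S.card ≤ 2 ^ (a * m) * (t + 2) ^ b := by
  obtain ⟨a, b, h⟩ := h
  refine ⟨a, b + 2 * a, fun m t ht u v hu hv R S hS => ?_⟩
  rcases S.eq_empty_or_nonempty with rfl | hne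
  · simp
  have hT := tailSupport_nonempty_of_isCellFamily hS hne
  obtain ⟨w, hu', hv', -, -, -, hcell, -, hnod⟩ := exists_noDatum_padding ht u v hu hv hT (N := 1) le_rfl
  obtain ⟨R', hS'⟩ := hcell R S hS
  have hbound := h (m + 4) t ht (Fin.append u w) (Fin.append v w) hu' hv' hnod R' S hS'
  have h16 : 2 ^ (a * (m + 4)) = 2 ^ (a * m) * 16 ^ a := by
    rw [mul_add, pow_add, show 2 ^ (a * 4) = 16 ^ a by rw [mul_comm, pow_mul]; norm_num]
  have h16le : 16 ^ a ≤ (t + 2) ^ (2 * a) := by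
    rw [pow_mul]
    exact Nat.pow_le_pow_left (by nlinarith) a
  calc S.card ≤ 2 ^ (a * (m + 4)) * (t + 2) ^ b := hbound
    _ = 2 ^ (a * m) * 16 ^ a * (t + 2) ^ b := by rw [h16]
    _ ≤ 2 ^ (a * m) * (t + 2) ^ (2 * a) * (t + 2) ^ b := Nat.mul_le_mul_right _ (Nat.mul_le_mul_left _ h16le)
    _ = 2 ^ (a * m) * (t + 2) ^ (b + 2 * a) := by rw [pow_add]; ring

/-- The no-datum residual and the full per-cell law are EQUIVALENT as `∃ a b` laws. [folklore] -/
theorem noDatumCellLaw_iff_cellLaw :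
    (∃ a b : ℕ, ∀ (m t : ℕ), 2 ≤ t → ∀ (u v : Fin m → MvPolynomial (Fin 2) ℂ),
      (∀ j, coeff 0 (u j) = 0 ∧ (u j).support.card ≤ t) → (∀ j, coeff 0 (v j) = 0 ∧ (v j).support.card ≤ t) →
      (∀ ρp ρm : Expo →₀ ℕ, ¬ RankOneCoincidences (fun j => (u j).support ∪ (v j).support) ρp ρm) →
      ∀ (R : Expo → Expo → Prop) (S : Finset Expo), IsCellFamily u v R S → S.card ≤ 2 ^ (a * m) * (t + 2) ^ b) ↔
    (∃ a b : ℕ, ∀ (m t : ℕ), 2 ≤ t → ∀ (u v : Fin m → MvPolynomial (Fin 2) ℂ),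
      (∀ j, coeff 0 (u j) = 0 ∧ (u j).support.card ≤ t) → (∀ j, coeff 0 (v j) = 0 ∧ (v j).support.card ≤ t) →
      ∀ (R : Expo → Expo → Prop) (S : Finset Expo), IsCellFamily u v R S → S.card ≤ 2 ^ (a * m) * (t + 2) ^ b) :=
  ⟨cellLaw_of_noDatumCellLaw, fun ⟨a, b, h⟩ => ⟨a, b, fun m t ht u v hu hv _ R S hS => h m t ht u v hu hv R S hS⟩⟩

/-- **The seven rank-one hatches of the v20 residual jointly carry no asymptotic content**: the per-cell law demanded only of instances
avoiding `FourTermRankOne`, `ThreeTermRankOne`, `ThreeTermAPRankOne`, `ThreeTermFreeRankOne`, `ThreeTermHomRankOne`, `ThreeTermGenRankOne` and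
`TwoTermRankOne` (inlined token-for-token) already implies the per-cell law for ALL instances (exponent `b ↦ b + 2a`).  Each hatch is a
rank-one datum, and the padded instance of `exists_noDatum_padding` has none. [folklore] -/
theorem cellLaw_of_datumHatchCellLaw
    (h : ∃ a b : ℕ, ∀ (m t : ℕ), 2 ≤ t → ∀ (u v : Fin m → MvPolynomial (Fin 2) ℂ),
      (∀ j, coeff 0 (u j) = 0 ∧ (u j).support.card ≤ t) → (∀ j, coeff 0 (v j) = 0 ∧ (v j).support.card ≤ t) →
      (¬ ∃ α β γ δ : Expo, α ≠ β ∧ α ≠ γ ∧ α ≠ δ ∧ β ≠ γ ∧ β ≠ δ ∧ γ ≠ δ ∧ α + β = γ + δ ∧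
          RankOneCoincidences (fun j => (u j).support ∪ (v j).support) (Finsupp.single γ 1 + Finsupp.single δ 1)
            (Finsupp.single α 1 + Finsupp.single β 1)) →
      (¬ ∃ α β γ : Expo, α ≠ β ∧ α ≠ γ ∧ β ≠ γ ∧ α = β + γ ∧
          RankOneCoincidences (fun j => (u j).support ∪ (v j).support) (Finsupp.single β 1 + Finsupp.single γ 1)
            (Finsupp.single α 1)) →
      (¬ ∃ α β γ : Expo, α ≠ β ∧ α ≠ γ ∧ β ≠ γ ∧ α + γ = β + β ∧
          RankOneCoincidences (fun j => (u j).support ∪ (v j).support) (Finsupp.single β 2)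
            (Finsupp.single α 1 + Finsupp.single γ 1)) →
      (¬ ∃ (α β γ : Expo) (q r : ℕ), 1 ≤ q ∧ 1 ≤ r ∧ α ≠ β ∧ α ≠ γ ∧ β ≠ γ ∧ α = q • β + r • γ ∧
          RankOneCoincidences (fun j => (u j).support ∪ (v j).support) (Finsupp.single β q + Finsupp.single γ r)
            (Finsupp.single α 1)) →
      (¬ ∃ α β γ : Expo, ∃ q r : ℕ, α ≠ β ∧ α ≠ γ ∧ β ≠ γ ∧ 1 ≤ q ∧ 1 ≤ r ∧ q • α + r • γ = (q + r) • β ∧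
          RankOneCoincidences (fun j => (u j).support ∪ (v j).support) (Finsupp.single β (q + r))
            (Finsupp.single α q + Finsupp.single γ r)) →
      (¬ ∃ (α β γ : Expo) (p q r : ℕ), 1 ≤ p ∧ 1 ≤ q ∧ 1 ≤ r ∧ α ≠ β ∧ α ≠ γ ∧ β ≠ γ ∧ p • α = q • β + r • γ ∧
          RankOneCoincidences (fun j => (u j).support ∪ (v j).support) (Finsupp.single β q + Finsupp.single γ r)
            (Finsupp.single α p)) →
      (¬ ∃ (α β : Expo) (p q : ℕ), 1 ≤ p ∧ 1 ≤ q ∧ α ≠ β ∧ p • α = q • β ∧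
          RankOneCoincidences (fun j => (u j).support ∪ (v j).support) (Finsupp.single β q) (Finsupp.single α p)) →
      ∀ (R : Expo → Expo → Prop) (S : Finset Expo), IsCellFamily u v R S → S.card ≤ 2 ^ (a * m) * (t + 2) ^ b) :
    ∃ a b : ℕ, ∀ (m t : ℕ), 2 ≤ t → ∀ (u v : Fin m → MvPolynomial (Fin 2) ℂ),
      (∀ j, coeff 0 (u j) = 0 ∧ (u j).support.card ≤ t) → (∀ j, coeff 0 (v j) = 0 ∧ (v j).support.card ≤ t) →
      ∀ (R : Expo → Expo → Prop) (S : Finset Expo), IsCellFamily u v R S → S.card ≤ 2 ^ (a * m) * (t + 2) ^ b := by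
  obtain ⟨a, b, h⟩ := h
  refine cellLaw_of_noDatumCellLaw ⟨a, b, fun m t ht u v hu hv hnod R S hS => h m t ht u v hu hv ?_ ?_ ?_ ?_ ?_ ?_ ?_ R S hS⟩
  · rintro ⟨α, β, γ, δ, -, -, -, -, -, -, -, hR⟩; exact hnod _ _ hR
  · rintro ⟨α, β, γ, -, -, -, -, hR⟩; exact hnod _ _ hR
  · rintro ⟨α, β, γ, -, -, -, -, hR⟩; exact hnod _ _ hR
  · rintro ⟨α, β, γ, q, r, -, -, -, -, -, -, hR⟩; exact hnod _ _ hR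
  · rintro ⟨α, β, γ, q, r, -, -, -, -, -, -, hR⟩; exact hnod _ _ hR
  · rintro ⟨α, β, γ, p, q, r, -, -, -, -, -, -, -, hR⟩; exact hnod _ _ hR
  · rintro ⟨α, β, p, q, -, -, -, -, hR⟩; exact hnod _ _ hR

end Summit.ValiantsHypothesis.Theorems.TwoProducts.Negative.RankTwoPadding
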